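import Mathlib.Topology.Order.IntermediateValue
import Mathlib.Topology.Instances.Real.Lemmas
import HarnessLib

/-!
# Continuous families of injective functions on an interval have one monotonicity type

Topic: Topology (general order topology), used for the orientation of the horizontals of a prong
star (`PlanarFoliations`). A continuous `f : ℝ × ℝ → ℝ` on `[a, b] × J`, `J` preconnected, with
`a < b` and every slice `f(·, h)`, `h ∈ J`, injective on `[a, b]`, has **all slices strictly
increasing or all slices strictly decreasing** (`strictMonoOn_forall_or_strictAntiOn_forall`):
each slice is strictly monotone or antitone (`ContinuousOn.strictMonoOn_of_injOn_Icc'`), and the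
sign of `f (b, h) - f (a, h)`, continuous and never zero on `J`, is constant.

All statements are [folklore].
-/

noncomputable section

open Set
open _root_.Topology

namespace Literature.Topology.PlanarFoliations

/-- **A continuous family of injective functions on `[a, b]` over a preconnected parameter set is
uniformly strictly increasing or uniformly strictly decreasing.** [folklore] -/
theorem strictMonoOn_forall_or_strictAntiOn_forall {f : ℝ × ℝ → ℝ} {a b : ℝ} (hab : a < b) {J : Set ℝ} (hJ : IsPreconnected J)
    (hf : ContinuousOn f (Icc a b ×ˢ J)) (hinj : ∀ h ∈ J, InjOn (fun x ↦ f (x, h)) (Icc a b)) :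
    (∀ h ∈ J, StrictMonoOn (fun x ↦ f (x, h)) (Icc a b)) ∨ (∀ h ∈ J, StrictAntiOn (fun x ↦ f (x, h)) (Icc a b)) := by
  -- each slice is strictly monotone or antitone
  have hslice : ∀ h ∈ J, StrictMonoOn (fun x ↦ f (x, h)) (Icc a b) ∨ StrictAntiOn (fun x ↦ f (x, h)) (Icc a b) := fun h hh ↦
    ContinuousOn.strictMonoOn_of_injOn_Icc' hab.le
      (hf.comp (continuous_id.prodMk continuous_const).continuousOn fun x hx ↦ ⟨hx, hh⟩) (hinj h hh)
  -- the end difference is continuous and never zero on `J`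
  set d : ℝ → ℝ := fun h ↦ f (b, h) - f (a, h) with hd
  have hdc : ContinuousOn d J :=
    (hf.comp (continuous_const.prodMk continuous_id).continuousOn fun h hh ↦ ⟨right_mem_Icc.2 hab.le, hh⟩).sub
      (hf.comp (continuous_const.prodMk continuous_id).continuousOn fun h hh ↦ ⟨left_mem_Icc.2 hab.le, hh⟩)
  have hdne : ∀ h ∈ J, d h ≠ 0 := fun h hh hd0 ↦
    hab.ne (hinj h hh (left_mem_Icc.2 hab.le) (right_mem_Icc.2 hab.le) (sub_eq_zero.1 hd0).symm)
  have hmono_iff : ∀ h ∈ J, (StrictMonoOn (fun x ↦ f (x, h)) (Icc a b) ↔ 0 < d h) := fun h hh ↦ by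
    constructor
    · intro hm; exact sub_pos.2 (hm (left_mem_Icc.2 hab.le) (right_mem_Icc.2 hab.le) hab)
    · intro hpos
      rcases hslice h hh with hm | ha
      · exact hm
      · exact absurd (sub_neg.2 (ha (left_mem_Icc.2 hab.le) (right_mem_Icc.2 hab.le) hab)) (not_lt.2 hpos.le)
  -- `d` takes one sign on the preconnected `J` (intermediate value)
  rcases J.eq_empty_or_nonempty with rfl | ⟨h₀, hh₀⟩
  · exact Or.inl fun h hh ↦ hh.elim
  rcases lt_or_gt_of_ne (hdne h₀ hh₀) with hneg | hpos
  · -- all negative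
    right
    intro h hh
    have hlt : d h < 0 := by
      by_contra hge
      push Not at hge
      have h0mem : (0 : ℝ) ∈ d '' J := hJ.intermediate_value hh₀ hh hdc ⟨hneg.le, hge⟩
      obtain ⟨h', hh', hd'⟩ := h0mem
      exact hdne h' hh' hd'
    rcases hslice h hh with hm | ha
    · exact absurd ((hmono_iff h hh).1 hm) (not_lt.2 hlt.le)
    · exact ha
  · -- all positive
    left
    intro h hh
    have hgt : 0 < d h := by
      by_contra hle
      push Not at hle
      have h0mem : (0 : ℝ) ∈ d '' J := hJ.intermediate_value hh hh₀ hdc ⟨hle, hpos.le⟩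
      obtain ⟨h', hh', hd'⟩ := h0mem
      exact hdne h' hh' hd'
    exact (hmono_iff h hh).2 hgt

end Literature.Topology.PlanarFoliations
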